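import Summits.QuantumFields.BalabanUV.Beta.EriceRemainderEnclosureHistoryAutonomyComparisonDualConcaveRow
import Summits.QuantumFields.BalabanUV.Beta.EriceRemainderEnclosureHistoryAutonomyComparisonDualComparison

/-!
# EriceRemainderEnclosureHistoryAutonomyComparisonDualConcaveGauge — (E136b) **THE GAUGE STEP FOR SEPARABLE CONCAVE MEMORY.**  Setting of (E136a)
# `…ComparisonDualConcaveRow`: `B u = β₀ + Σ_{k<K} f_k(u_k)` (`β₀ > 0`; `f_k ≥ 0` non-decreasing, `f_k(u)∕u` non-increasing, `f_k` concave on ]0,γ]; floor, modulus, unique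
# box solutions), `B′ ≥ B` with ISOTONE excess, one perturbed orbit `h′`, dual steps `X′_m`, gauge `g_m = X′_m·h′_m²`.  **`concave_gauge_step`**: if `X′_m ≥ 0` and
# `g_{m+1} ≤ g_m` for all `m ≥ n+1` then `X′_n ≥ 0` and `g_{n+1} ≤ g_n` — (E134) `gauge_step` with the chord slopes `λ_k` for `L_k` ((E136a) `concave_row_ge`; the window and
# rise lemmas of (E134) are base-general).  THE ONE NEW POINT is the per-age budget: since the two base orbits from `(S h′_n)_1` and `h′_{n+1}` have level gap at age `k` at
# most their pin gap `X′_n ≤ Φ′_n` ((E132) `base_gap_damped`), `σ²·u1 ≤ x²(σ² + u1) ≤ 2u0·x²` (`σ = (S h′_n)_{1+k}`, `x = x_k`, `u0 = h′_n²`, `u1 = h′_{n+1}²`), i.e. the first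
# entry is paid INSIDE the window share: `λ(σ²x∕2) + u0·λ(x − x³∕u1) ≤ u0·λ·x ≤ u0·f_k(x) ≤ u0·f_k(σ)` — no appeal to `ρ = σ∕x` (which a saturating `f_k` could not afford).

Cell `pub-balaban`, β-function sub-cell, BINDER row D4 «RemainderConst leaves for Bałaban's split» (`HOME/BINDER-OWNERS.md`; owner lineage `b2b-balaban-beta-an4`;
this file by co-owner #2 lineage `b2b-balaban-beta-d4-p2`, generation 104), β-FLOW TEAM duty (1), FREEZE (0) honoured (def-free; imports (E136a) and (E135b); uses (E136a)
`chord_slope_facts` ∕ `concave_step_eq_drop` ∕ `concave_row_ge`, (E135a) `gauge_of_row`, (E134) `steps_mul_le_rise` ∕ `cmp_from_pin` ∕ `source_chain` ∕ `pert_step_le_level` ∕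
`gauge_window_le`, (E133) `coupling_gap_le` ∕ `dual_two_pin_le`, (E132) `base_gap_damped` ∕ `dual_source_antitone` ∕ `dual_gap_le_sum_steps` ∕ `cmp_of_dual_steps_nonneg`,
(E48a) `family_zero` ∕ `family_mem` ∕ `family_tail_eq` ∕ `le_of_pin_le` ∕ `strictAnti_of_memFlow` BY NAME; nothing restated).

HONEST FRAMING (page 1, verbatim and binding).  *"Discharging BetaPertH makes Bałaban's UV stability UNCONDITIONAL — a real constructive-QFT result; it is
NOT the continuum limit and NOT the Clay problem."*  THIS FILE DISCHARGES NOTHING OF THE KIND.  Elementary real analysis about ABSTRACT functionals on a box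
]0,γ]^ℕ — hypotheses of a census, not facts; the form, signs, ages and moments of Bałaban's (1.22) limit functional are NOT PRINTED ([I] p. 298; GAPS
G-t4-U2-1∕-2) and NOT asserted.  Row D4 class UNCHANGED (critical-path width 0; instance 0∕1; D4 DISCHARGE NO DATE).  NOT CLAIMED here: the comparison theorem (the
sequel (E136c)); anything printed — NOT B12 Thm 2, NOT BetaPertH, NOT continuum, NOT Clay.

WHAT IS PROVED ([folklore]; 0 `def`, 0 sorry).  `concave_step_le_excess`, **`concave_gauge_step`**.
-/

noncomputable section
open Finset Set

namespace Summit.QuantumFields.BalabanUV.Beta.EriceRemainderEnclosureHistoryAutonomyComparisonDualConcaveGauge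

open Literature.MathematicalPhysics.QuantumFieldTheory.Balaban1983to89
open Literature.MathematicalPhysics.QuantumFieldTheory.Balaban1983to89.T4BetaStationary
open Literature.MathematicalPhysics.QuantumFieldTheory.Balaban1983to89.T4BetaFlowWellPosed
open Summit.QuantumFields.BalabanUV.Beta.EriceRemainderEnclosureHistoryAutonomyOrder
  (family_zero family_mem family_tail_eq family_succ_eq le_of_pin_le strictAnti_of_memFlow)
open Summit.QuantumFields.BalabanUV.Beta.EriceRemainderEnclosureHistoryAutonomyComparisonDualOrbit
  (base_gap_damped dual_source_antitone dual_gap_le_sum_steps cmp_of_dual_steps_nonneg)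
open Summit.QuantumFields.BalabanUV.Beta.EriceRemainderEnclosureHistoryAutonomyComparisonDualRow (coupling_gap_le dual_two_pin_le)
open Summit.QuantumFields.BalabanUV.Beta.EriceRemainderEnclosureHistoryAutonomyComparisonDualGauge
  (steps_mul_le_rise cmp_from_pin source_chain pert_step_le_level gauge_window_le)
open Summit.QuantumFields.BalabanUV.Beta.EriceRemainderEnclosureHistoryAutonomyComparisonDualDeep (gauge_of_row)
open Summit.QuantumFields.BalabanUV.Beta.EriceRemainderEnclosureHistoryAutonomyComparisonDualComparison (level_ge_floor)
open Summit.QuantumFields.BalabanUV.Beta.EriceRemainderEnclosureHistoryAutonomyComparisonDualConcaveRow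
  (chord_slope_facts concave_step_eq_drop concave_row_ge)

variable {B B' : (ℕ → ℝ) → ℝ} {M γ b β₀ : ℝ} {f : ℕ → ℝ → ℝ} {K : ℕ} {S : ℝ → ℕ → ℝ} {h' : ℕ → ℝ}

/-! ## §1 The gauge step for separable concave memory -/

/-- THE DUAL STEP NEVER EXCEEDS THE EXCESS (separable memory, `f_k` non-decreasing): under comparison from the pin `h′_m`, `X′_m ≤ E_m`. [folklore] -/
theorem concave_step_le_excess (hBf : ∀ u, SeqBox γ u → B u = β₀ + ∑ k ∈ range K, f k (u k))
    (hfmono : ∀ k a c, 0 < a → a ≤ c → c ≤ γ → f k a ≤ f k c)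
    (hS : ∀ p, 0 < p → p ≤ γ → SeqBox γ (S p) ∧ MemFlow B p (S p)) (hh' : SeqBox γ h') (m : ℕ)
    (hcmp : ∀ l, h' (m + l) ≤ S (h' m) l) :
    B' (fun i => h' (m + 1 + i)) - B (fun i => S (h' m) (1 + i))
      ≤ B' (fun i => h' (m + 1 + i)) - B (fun i => h' (m + 1 + i)) := by
  rw [concave_step_eq_drop (B' := B') hBf hS hh' m]
  have : 0 ≤ ∑ k ∈ range K, (f k (S (h' m) (1 + k)) - f k (h' (m + 1 + k))) :=
    sum_nonneg fun k _ => by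
      have hc := hcmp (1 + k); rw [show m + (1 + k) = m + 1 + k by ring] at hc
      have := hfmono k (h' (m + 1 + k)) (S (h' m) (1 + k)) (hh' _).1 hc ((hS (h' m) (hh' m).1 (hh' m).2).1 (1 + k)).2
      linarith
  linarith

set_option maxHeartbeats 800000 in
/-- **THE GAUGE STEP FOR SEPARABLE CONCAVE MEMORY.**  `B u = β₀ + Σ_{k<K} f_k(u_k)` (`β₀ > 0`; `f_k ≥ 0` non-decreasing, `f_k(u)∕u` non-increasing, `f_k` concave on
]0,γ]; floor, modulus, unique box solutions `S p`), `B′ ≥ B` with ISOTONE excess, `h′` a box solution of `B′`, dual steps `X′_m`, gauge `g_m = X′_m·h′_m²`.  If `X′_m ≥ 0` and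
`g_{m+1} ≤ g_m` for every `m ≥ n+1`, then `X′_n ≥ 0` and `g_{n+1} ≤ g_n` — (E134) `gauge_step` with the chord slopes `λ_k` in place of `L_k`; the only new point is the per-age
budget `λ_k·x_k·(θ∕2 + 1 − x) ≤ λ_k·x_k ≤ f_k(x_k) ≤ f_k((S h′_n)_{1+k})`, via `θ ≤ x` (the level gap of the two base orbits at age `k` is at most their pin gap). [folklore] -/
theorem concave_gauge_step (hBf : ∀ u, SeqBox γ u → B u = β₀ + ∑ k ∈ range K, f k (u k)) (hβ : 0 < β₀)
    (hf0 : ∀ k a, 0 < a → a ≤ γ → 0 ≤ f k a) (hfratio : ∀ k a c, 0 < a → a ≤ c → c ≤ γ → f k c * a ≤ f k a * c)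
    (hfconc : ∀ k a c d e, 0 < a → a < c → 0 < d → d < e → a ≤ d → c ≤ e → e ≤ γ → (f k e - f k d) * (c - a) ≤ (f k c - f k a) * (e - d))
    (hfmono : ∀ k a c, 0 < a → a ≤ c → c ≤ γ → f k a ≤ f k c)
    (hb : 0 < b)
    (hmono : ∀ u v : ℕ → ℝ, SeqBox γ u → SeqBox γ v → (∀ i, u i ≤ v i) → B u ≤ B v)
    (hB : ∀ u u' : ℕ → ℝ, SeqBox γ u → SeqBox γ u' → ∀ D : ℝ, (∀ j, |u j - u' j| ≤ D) → |B u - B u'| ≤ M * D) (hM : 0 ≤ M)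
    (hlo : ∀ u, SeqBox γ u → b ≤ B u)
    (hS : ∀ p, 0 < p → p ≤ γ → SeqBox γ (S p) ∧ MemFlow B p (S p))
    (huniq : ∀ p, 0 < p → p ≤ γ → ∀ u u' : ℕ → ℝ, SeqBox γ u → SeqBox γ u' → MemFlow B p u → MemFlow B p u' → u = u')
    (hexc : ∀ u, SeqBox γ u → B u ≤ B' u)
    (hDmono : ∀ u v : ℕ → ℝ, SeqBox γ u → SeqBox γ v → (∀ i, u i ≤ v i) → B' u - B u ≤ B' v - B v)
    (hh' : SeqBox γ h') {y : ℝ} (hf' : MemFlow B' y h') (n : ℕ)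
    (hXup : ∀ l, 0 ≤ B' (fun i => h' (n + 1 + l + 1 + i)) - B (fun i => S (h' (n + 1 + l)) (1 + i)))
    (hg : ∀ m, n + 1 ≤ m → (B' (fun i => h' (m + 1 + 1 + i)) - B (fun i => S (h' (m + 1)) (1 + i))) * h' (m + 1) ^ 2
      ≤ (B' (fun i => h' (m + 1 + i)) - B (fun i => S (h' m) (1 + i))) * h' m ^ 2) :
    0 ≤ B' (fun i => h' (n + 1 + i)) - B (fun i => S (h' n) (1 + i))
      ∧ (B' (fun i => h' (n + 1 + 1 + i)) - B (fun i => S (h' (n + 1)) (1 + i))) * h' (n + 1) ^ 2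
        ≤ (B' (fun i => h' (n + 1 + i)) - B (fun i => S (h' n) (1 + i))) * h' n ^ 2 := by
  -- derived facts
  have hmono' : ∀ u v : ℕ → ℝ, SeqBox γ u → SeqBox γ v → (∀ i, u i ≤ v i) → B' u ≤ B' v := fun u v hu hv hle => by
    linarith [hmono u v hu hv hle, hDmono u v hu hv hle]
  have hlo' : ∀ u, SeqBox γ u → b ≤ B' u := fun u hu => (hlo u hu).trans (hexc u hu)
  have hanti : Antitone h' := (strictAnti_of_memFlow hb hlo' hh' hf').antitone
  have hpos : ∀ j, 0 < h' j := fun j => (hh' j).1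
  have hcmp : ∀ l, h' (n + 1 + l) ≤ S (h' (n + 1)) l := cmp_from_pin (B' := B') hb hB hM hlo hS huniq hh' hf' (n + 1) hXup
  have hp1 := hh' (n + 1)
  have hpn := hh' n
  have hS1 := hS (h' (n + 1)) hp1.1 hp1.2
  have hSn := hS (h' n) hpn.1 hpn.2
  have hxpos : ∀ k, 0 < S (h' (n + 1)) k := fun k => (hS1.1 k).1
  have hx0 : S (h' (n + 1)) 0 = h' (n + 1) := family_zero hS hp1.1 hp1.2
  have hxanti' := strictAnti_of_memFlow hb hlo hS1.1 hS1.2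
  have hxanti := hxanti'.antitone
  have hσanti := (strictAnti_of_memFlow hb hlo hSn.1 hSn.2).antitone
  set X0 : ℝ := B' (fun i => h' (n + 1 + i)) - B (fun i => S (h' n) (1 + i)) with hX0
  set X1 : ℝ := B' (fun i => h' (n + 1 + 1 + i)) - B (fun i => S (h' (n + 1)) (1 + i)) with hX1
  set u0 : ℝ := h' n ^ 2 with hu0
  set u1 : ℝ := h' (n + 1) ^ 2 with hu1
  -- the chord slopes
  set lam : ℕ → ℝ := fun k => (f k (S (h' (n + 1)) k) - f k (S (h' (n + 1)) (k + 1))) / (S (h' (n + 1)) k - S (h' (n + 1)) (k + 1)) with hlamdef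
  have hlamk : ∀ k, 0 ≤ lam k ∧ lam k * S (h' (n + 1)) (k + 1) ≤ f k (S (h' (n + 1)) (k + 1)) ∧ lam k * S (h' (n + 1)) k ≤ f k (S (h' (n + 1)) k) := by
    intro k
    have hxpx : S (h' (n + 1)) (k + 1) < S (h' (n + 1)) k := hxanti' (Nat.lt_succ_self k)
    have hxγ : S (h' (n + 1)) k ≤ γ := (hS1.1 k).2
    exact chord_slope_facts hxpx (hfmono k _ _ (hxpos (k + 1)) hxpx.le hxγ) (hfratio k _ _ (hxpos (k + 1)) hxpx.le hxγ)
  have hu0p : 0 < u0 := pow_pos (hpos n) 2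
  have hu1p : 0 < u1 := pow_pos (hpos (n + 1)) 2
  have hu10 : u1 ≤ u0 := pow_le_pow_left₀ (hpos _).le (hanti (Nat.le_succ n)) 2
  have hX1nn : 0 ≤ X1 := by have := hXup 0; simp only [Nat.add_zero] at this; exact this
  have hlev0 : X0 = 1 / h' (n + 1) ^ 2 - 1 / h' n ^ 2 - B (fun i => S (h' n) (1 + i)) := by rw [hX0, hf'.2 n]; ring
  have hlev1 : B' (fun i => h' (n + 1 + 1 + i)) = 1 / h' (n + 1 + 1) ^ 2 - 1 / h' (n + 1) ^ 2 := by rw [hf'.2 (n + 1)]; ring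
  have hΦ00 : B (fun i => S (h' (n + 1)) (1 + i)) ≤ 1 / u1 := by
    have h1 : B (fun i => S (h' (n + 1)) (1 + i)) ≤ B' (fun i => h' (n + 1 + 1 + i)) := by linarith [hX1nn]
    have h2 := pert_step_le_level hmono' hb hlo' hh' hf' (m := n + 1) (by omega)
    rw [hlev1] at h1; simp only [hu1]; linarith
  -- the row inequality
  have hrow := concave_row_ge (B' := B') hBf hβ.le hf0 hfratio hfconc hfmono hb hmono hB hM hlo hS huniq hlo' hDmono hh' hf' n hcmp hXup
  -- the deficit sum through the gauge
  set C : ℝ := ∑ k ∈ range K, lam k * (S (h' (n + 1)) k - S (h' (n + 1)) k ^ 3 / u1) with hC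
  have hdef : ∑ k ∈ range K, lam k * (S (h' (n + 1)) k ^ 3 * (1 / S (h' (n + 1)) (k + 1) ^ 2 - 1 / S (h' (n + 1)) k ^ 2)
        * (h' (n + 1 + k) ^ 2 * (1 / h' (n + 1 + k) ^ 2 - 1 / S (h' (n + 1)) k ^ 2))) ≤ X1 * u1 * C := by
    rw [hC, mul_sum]
    refine sum_le_sum fun k _ => ?_
    have hw := gauge_window_le (B' := B') hb hmono hB hM hlo hS huniq hh' hanti hf' n k hXup hg
    have hrise := steps_mul_le_rise hmono hb hlo hS1.1 hS1.2 k
    rw [hx0] at hrise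
    have hxk := hxpos k
    have hΦk : 0 ≤ 1 / S (h' (n + 1)) (k + 1) ^ 2 - 1 / S (h' (n + 1)) k ^ 2 := by
      rw [hS1.2.2 k]; linarith [hlo _ (seqBox_shift hS1.1 (k + 1))]
    have hg1 : 0 ≤ X1 * u1 := mul_nonneg hX1nn hu1p.le
    have step1 : S (h' (n + 1)) k ^ 3 * (1 / S (h' (n + 1)) (k + 1) ^ 2 - 1 / S (h' (n + 1)) k ^ 2)
        * (h' (n + 1 + k) ^ 2 * (1 / h' (n + 1 + k) ^ 2 - 1 / S (h' (n + 1)) k ^ 2))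
        ≤ S (h' (n + 1)) k ^ 3 * (1 / S (h' (n + 1)) (k + 1) ^ 2 - 1 / S (h' (n + 1)) k ^ 2) * ((k : ℝ) * (X1 * u1)) :=
      mul_le_mul_of_nonneg_left hw (by positivity)
    have step2 : S (h' (n + 1)) k ^ 3 * ((k : ℝ) * (1 / S (h' (n + 1)) (k + 1) ^ 2 - 1 / S (h' (n + 1)) k ^ 2))
        ≤ S (h' (n + 1)) k ^ 3 * (1 / S (h' (n + 1)) k ^ 2 - 1 / h' (n + 1) ^ 2) :=
      mul_le_mul_of_nonneg_left hrise (by positivity)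
    have e3 : S (h' (n + 1)) k ^ 3 * (1 / S (h' (n + 1)) k ^ 2 - 1 / h' (n + 1) ^ 2) = S (h' (n + 1)) k - S (h' (n + 1)) k ^ 3 / u1 := by
      simp only [hu1]; field_simp
    have step3 := mul_le_mul_of_nonneg_left step2 hg1
    rw [e3] at step3
    have hk : S (h' (n + 1)) k ^ 3 * (1 / S (h' (n + 1)) (k + 1) ^ 2 - 1 / S (h' (n + 1)) k ^ 2)
        * (h' (n + 1 + k) ^ 2 * (1 / h' (n + 1 + k) ^ 2 - 1 / S (h' (n + 1)) k ^ 2))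
        ≤ X1 * u1 * (S (h' (n + 1)) k - S (h' (n + 1)) k ^ 3 / u1) :=
      calc _ ≤ S (h' (n + 1)) k ^ 3 * (1 / S (h' (n + 1)) (k + 1) ^ 2 - 1 / S (h' (n + 1)) k ^ 2) * ((k : ℝ) * (X1 * u1)) := step1
        _ = X1 * u1 * (S (h' (n + 1)) k ^ 3 * ((k : ℝ) * (1 / S (h' (n + 1)) (k + 1) ^ 2 - 1 / S (h' (n + 1)) k ^ 2))) := by ring
        _ ≤ X1 * u1 * (S (h' (n + 1)) k - S (h' (n + 1)) k ^ 3 / u1) := step3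
    have := mul_le_mul_of_nonneg_left hk (hlamk k).1
    linarith [this]
  -- the coefficient C is paid by the budget at the pin h′_{n+1}:  u1·C ≤ 1 − u1·β₀ < 1
  have hCle : C ≤ ∑ k ∈ range K, f k (S (h' (n + 1)) (1 + k)) := by
    rw [hC]
    refine sum_le_sum fun k _ => ?_
    obtain ⟨hl0, hlxp, _⟩ := hlamk k
    have hxk := hxpos k
    have hxk1 := hxpos (k + 1)
    have hle : S (h' (n + 1)) (k + 1) ≤ S (h' (n + 1)) k := hxanti (Nat.le_succ k)
    have hgap := coupling_gap_le hxk1 hle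
    have hΦk : 1 / S (h' (n + 1)) (k + 1) ^ 2 - 1 / S (h' (n + 1)) k ^ 2 ≤ 1 / u1 := by
      have e1 : 1 / S (h' (n + 1)) (k + 1) ^ 2 - 1 / S (h' (n + 1)) k ^ 2 = B (fun i => S (h' (n + 1)) (k + 1 + i)) := by
        rw [hS1.2.2 k]; ring
      have hdec : B (fun i => S (h' (n + 1)) (k + 1 + i)) ≤ B (fun i => S (h' (n + 1)) (0 + 1 + i)) :=
        hmono _ _ (seqBox_shift hS1.1 (k + 1)) (seqBox_shift hS1.1 (0 + 1)) fun i => hxanti (by omega)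
      have e0 : (fun i => S (h' (n + 1)) (0 + 1 + i)) = (fun i => S (h' (n + 1)) (1 + i)) := by funext i; simp
      rw [e0] at hdec
      rw [e1]; exact hdec.trans hΦ00
    have hΦk0 : 0 ≤ 1 / S (h' (n + 1)) (k + 1) ^ 2 - 1 / S (h' (n + 1)) k ^ 2 := by
      rw [hS1.2.2 k]; linarith [hlo _ (seqBox_shift hS1.1 (k + 1))]
    have h1 : (1 / S (h' (n + 1)) (k + 1) ^ 2 - 1 / S (h' (n + 1)) k ^ 2) * (S (h' (n + 1)) k ^ 2 * S (h' (n + 1)) (k + 1) / 2)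
        ≤ 1 / u1 * (S (h' (n + 1)) k ^ 2 * S (h' (n + 1)) k / 2) :=
      mul_le_mul hΦk (by nlinarith [mul_le_mul_of_nonneg_left hle (sq_nonneg (S (h' (n + 1)) k))]) (by positivity) (by positivity)
    have h2 : 1 / u1 * (S (h' (n + 1)) k ^ 2 * S (h' (n + 1)) k / 2) ≤ S (h' (n + 1)) k ^ 3 / u1 := by
      rw [le_div_iff₀ hu1p]
      have e : 1 / u1 * (S (h' (n + 1)) k ^ 2 * S (h' (n + 1)) k / 2) * u1 = S (h' (n + 1)) k ^ 3 / 2 := by field_simp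
      rw [e]; nlinarith [pow_pos hxk 3]
    -- λ·(x − x³/u1) ≤ λ·x₊ ≤ f(x₊)
    have h3 : S (h' (n + 1)) k - S (h' (n + 1)) k ^ 3 / u1 ≤ S (h' (n + 1)) (k + 1) := by linarith [hgap, h1, h2]
    rw [show 1 + k = k + 1 by ring]
    exact (mul_le_mul_of_nonneg_left h3 hl0).trans hlxp
  have hbudget1 : u1 * (∑ k ∈ range K, f k (S (h' (n + 1)) (1 + k))) ≤ 1 - u1 * β₀ := by
    have e : ∑ k ∈ range K, f k (S (h' (n + 1)) (1 + k)) = B (fun i => S (h' (n + 1)) (1 + i)) - β₀ := by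
      rw [hBf _ (fun i => hS1.1 (1 + i))]; ring
    rw [e]
    have := mul_le_mul_of_nonneg_left hΦ00 hu1p.le
    rw [mul_one_div_cancel hu1p.ne'] at this
    nlinarith [this]
  have hC1 : u1 * C < 1 := by
    have := mul_le_mul_of_nonneg_left hCle hu1p.le
    nlinarith [mul_pos hu1p hβ]
  -- the two cases of the sign of X′_n
  by_cases h0 : 0 ≤ X0
  · refine ⟨h0, ?_⟩
    rw [max_eq_left h0] at hrow
    have hle1 : h' (n + 1) ≤ S (h' n) 1 := by
      have hσ1 := (hSn.1 1).1
      refine (pow_le_pow_iff_left₀ (hpos (n + 1)).le hσ1.le two_ne_zero).mp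
        ((one_div_le_one_div (pow_pos hσ1 2) (pow_pos (hpos (n + 1)) 2)).mp ?_)
      have : 0 ≤ 1 / h' (n + 1) ^ 2 - 1 / h' n ^ 2 - B (fun i => S (h' n) (1 + i)) := by rw [← hlev0]; exact h0
      have e2 : 1 / S (h' n) (0 + 1) ^ 2 = 1 / S (h' n) 0 ^ 2 + B (fun i => S (h' n) (0 + 1 + i)) := hSn.2.2 0
      rw [family_zero hS hpn.1 hpn.2] at e2
      have e3 : (fun i => S (h' n) (0 + 1 + i)) = (fun i => S (h' n) (1 + i)) := by funext i; simp
      rw [e3] at e2; simp only [Nat.zero_add] at e2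
      linarith
    -- the two base orbits from (S h′_n)_1 and h′_{n+1}: level gap at age k ≤ pin gap = X0 ≤ Φ′_n = 1/u1 − 1/u0
    have hz := family_mem hS hpn.1 hpn.2 1
    have htail : (fun j => S (h' n) (1 + j)) = S (S (h' n) 1) := family_tail_eq hS huniq hpn.1 hpn.2 1
    have hkz := hS (S (h' n) 1) hz.1 hz.2
    have hleS : ∀ j, S (h' (n + 1)) j ≤ S (S (h' n) 1) j := fun j =>
      le_of_pin_le hb hB hM hlo huniq hp1.1 hle1 hz.2 hS1.1 hkz.1 hS1.2 hkz.2 j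
    have hB0 : 0 ≤ B (fun i => S (h' n) (1 + i)) := hb.le.trans (hlo _ (fun i => hSn.1 (1 + i)))
    have hpin : 1 / h' (n + 1) ^ 2 - 1 / S (h' n) 1 ^ 2 ≤ 1 / u1 - 1 / u0 := by
      have e2 : 1 / S (h' n) (0 + 1) ^ 2 = 1 / S (h' n) 0 ^ 2 + B (fun i => S (h' n) (0 + 1 + i)) := hSn.2.2 0
      rw [family_zero hS hpn.1 hpn.2] at e2
      have e3 : (fun i => S (h' n) (0 + 1 + i)) = (fun i => S (h' n) (1 + i)) := by funext i; simp
      rw [e3] at e2; simp only [Nat.zero_add] at e2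
      simp only [hu0, hu1]; linarith
    have hgapk : ∀ k, 1 / S (h' (n + 1)) k ^ 2 - 1 / S (h' n) (1 + k) ^ 2 ≤ 1 / u1 - 1 / u0 := by
      intro k
      have h1 := base_gap_damped hmono hkz.1 hkz.2 hS1.1 hS1.2 hleS k
      rw [← congrFun htail k] at h1
      exact h1.trans hpin
    -- the row condition, age by age: λ(σ²x/2) + u0·λ(x − x³/u1) ≤ u0·λ·x ≤ u0·f(x) ≤ u0·f(σ)
    have hcond : ∑ k ∈ range K, lam k * (S (h' n) (1 + k) ^ 2 * S (h' (n + 1)) k / 2) + u0 * C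
        ≤ u0 * ∑ k ∈ range K, f k (S (h' n) (1 + k)) := by
      rw [hC, mul_sum, mul_sum, ← sum_add_distrib]
      refine sum_le_sum fun k _ => ?_
      obtain ⟨hl0, _, hlx⟩ := hlamk k
      have hxk := hxpos k
      have hσ := (hSn.1 (1 + k)).1
      have hσγ := (hSn.1 (1 + k)).2
      obtain ⟨hρ0, _⟩ := dual_two_pin_le hb hmono hB hM hlo hS huniq hh' n hle1 k
      have hσu0 : S (h' n) (1 + k) ^ 2 ≤ u0 := by
        have : S (h' n) (1 + k) ≤ S (h' n) 0 := hσanti (Nat.zero_le _)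
        rw [family_zero hS hpn.1 hpn.2] at this
        exact pow_le_pow_left₀ hσ.le this 2
      -- from the level gap: σ²·u1 ≤ x²(σ² + u1) ≤ 2·u0·x²
      have hg := hgapk k
      have hkey : S (h' n) (1 + k) ^ 2 * u1 ≤ 2 * u0 * S (h' (n + 1)) k ^ 2 := by
        have hx2 : 0 < S (h' (n + 1)) k ^ 2 := pow_pos hxk 2
        have hs2 : 0 < S (h' n) (1 + k) ^ 2 := pow_pos hσ 2
        have h1 : 1 / S (h' (n + 1)) k ^ 2 ≤ 1 / u1 + 1 / S (h' n) (1 + k) ^ 2 := by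
          have : 0 < 1 / u0 := by positivity
          linarith
        have h2 := mul_le_mul_of_nonneg_left h1 (by positivity : (0:ℝ) ≤ S (h' (n + 1)) k ^ 2 * S (h' n) (1 + k) ^ 2 * u1)
        have e1 : S (h' (n + 1)) k ^ 2 * S (h' n) (1 + k) ^ 2 * u1 * (1 / S (h' (n + 1)) k ^ 2) = S (h' n) (1 + k) ^ 2 * u1 := by
          field_simp
        have e2 : S (h' (n + 1)) k ^ 2 * S (h' n) (1 + k) ^ 2 * u1 * (1 / u1 + 1 / S (h' n) (1 + k) ^ 2)
            = S (h' (n + 1)) k ^ 2 * (S (h' n) (1 + k) ^ 2 + u1) := by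
          field_simp
        rw [e1, e2] at h2
        nlinarith [hσu0, hu10, hx2]
      have hstep : S (h' n) (1 + k) ^ 2 * S (h' (n + 1)) k / 2 + u0 * (S (h' (n + 1)) k - S (h' (n + 1)) k ^ 3 / u1)
          ≤ u0 * S (h' (n + 1)) k := by
        have : S (h' n) (1 + k) ^ 2 * S (h' (n + 1)) k / 2 ≤ u0 * S (h' (n + 1)) k ^ 3 / u1 := by
          rw [le_div_iff₀ hu1p]; nlinarith [hkey, hxk]
        have e : u0 * (S (h' (n + 1)) k - S (h' (n + 1)) k ^ 3 / u1) = u0 * S (h' (n + 1)) k - u0 * S (h' (n + 1)) k ^ 3 / u1 := by ring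
        linarith [this, e]
      have hfx : lam k * S (h' (n + 1)) k ≤ f k (S (h' n) (1 + k)) := hlx.trans (hfmono k _ _ hxk (by linarith) hσγ)
      have := mul_le_mul_of_nonneg_left hstep hl0
      nlinarith [mul_le_mul_of_nonneg_left hfx hu0p.le]
    have hSg : ∑ k ∈ range K, f k (S (h' n) (1 + k)) = B (fun i => S (h' n) (1 + i)) - β₀ := by
      rw [hBf _ (fun i => hSn.1 (1 + i))]; ring
    have hΦ0 : B (fun i => S (h' n) (1 + i)) ≤ 1 / u1 - 1 / u0 := by rw [hlev0] at h0; simp only [hu0, hu1]; linarith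
    exact gauge_of_row hu0p hu1p hβ h0 hrow hdef hC1 hcond hSg hΦ0
  · exfalso
    have h0' : X0 < 0 := lt_of_not_ge h0
    rw [max_eq_right h0'.le, zero_mul, sub_zero] at hrow
    have A1 : X1 * (1 - u1 * C) ≤ X0 := by nlinarith [hrow, hdef]
    have A2 : 0 ≤ X1 * (1 - u1 * C) := mul_nonneg hX1nn (by linarith)
    linarith

end Summit.QuantumFields.BalabanUV.Beta.EriceRemainderEnclosureHistoryAutonomyComparisonDualConcaveGauge

end
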